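import Summits.AtomisticToContinuum.HydrodynamicLimit.Theorems.CollisionIsometryCLTAdaptedWeightCLTTimeLocal
import Literature.Analysis.FluidPDE.HardSphereCollisionRecord
import Literature.Analysis.FluidPDE.BoltzmannEquation
import Literature.MathematicalPhysics.KineticTheory.HardSphereTwoTimePressure
/-!
# Vocabulary of the line `block-h-dissipation-closure` for the crux `AdaptedWeightCLT`
(stmt-AtomisticToContinuum-14868, rev-12 TIME-LOCAL form; route `CollisionIsometryCLT`, sub-problem
`HydrodynamicLimit`)

Definitions-only support file (`--supports stmt-AtomisticToContinuum-14868`) of the line lead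
`prover-line-stmt-AtomisticToContinuum-14868-c4-0` (skeleton `Cruxes/AdaptedWeightCLT/Lines/block_h_dissipation_closure.lean`,
planner `planner-cruxplan-stmt-AtomisticToContinuum-14868-block-h-dissipation--0`). It makes the line's OBJECTS and
STATEMENTS importable so that each registered stub lands in its own sorry-free Theorems file with the registered
signature verbatim (the pattern of `…Theorems.ContactSourceDuhamel.TimeLocal` and `…Theorems.SustainedAnisotropy`).
Nothing is asserted: every `def … : Prop` is a predicate, never a hypothesis taken as a fact; the only theorems are
the two pieces of pure bookkeeping `budgetOn_of_decomp` and `conclOn_iff` (`Iff.rfl`).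

## Objects (all explicit over tree declarations)

For a cell kernel family `ψ` (an `AdmissibleKernel γc C' ψ` family — the crux's own kernel class at a larger
exponent `γc ∈ (1/6, 1/3)`: kinetic-but-populous cells, `m_cell = (N+1)^{1-3γc} → ∞`), a configuration `w`, a
location `x`:
* `cw, cW, cU, cT` — cell weights `ψ_N(x_i − x)`, total weight `W_x = (N+1) ρ̄(x)`, cell velocity `ū_x`, cell
  temperature `θ̄_x`;
* `kde h` — the Gaussian kernel density estimate `f̃_x = W_x⁻¹ Σ_i ψ_N(x_i − x) G_h(· − v_i)` of the cell velocity law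
  (`G_h(v − u) = localMaxwellian 1 (h²) u v`);
* `cellLaw h δ` — the REGULARISED CELL LAW `f̂_x = (1 − δ) f̃_x + δ M_{1, θ̄_x + h², ū_x}` (co-moving, co-thermal
  Maxwellian floor: same mean as the cell, `traceless Cov(f̂) = (1−δ) traceless Cov(f)`, `μ₃(f̂) = (1−δ) μ₃(f)`
  EXACTLY; at local equilibrium `f̂` IS Maxwellian, so every dissipation functional below vanishes there);
* `cellEnt`, `entS` — `H(f̂_x) = ∫ f̂ log f̂` and the mass-weighted regularised entropy `S_N(w) = ∫ₓ ρ̄ H(f̂_x)`;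
* `incr w w'` — the FIRST-ORDER entropy increment; `realDiss` — the REALISED first-order entropy dissipation on
  `(0, t]` (collision pair sum, tree `HardSphereFlow.collisionPairSum`, pre-collisional configuration read through the
  elastic involution `collidePair`); `transS` — the transport term; `bregS` — the collision pair sum of the Bregman
  remainders `S_N(post) − S_N(pre) − incr(pre, post) ≥ 0`; `collCount` — `Σ_{collisions} (1 + |v_i|² + |v_j|²)`;
* `fluxZ`, `hellDiss` — flux normalisation `Z(f) = ∫ B f f_*` and the normalised HELLINGER DISSIPATION
  `𝒟h(f) = (2Z)⁻¹ ∫ B (√(f′f′_*) − √(f f_*))² ∈ [0, 1]` (`B = hardSphereKernel`, `collide`, `sphereMeasure`);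
* `chaosDiss` — the chaotic dissipation CHARGED TO THE REALISED CONTACTS; `massDiss` — the mass-weighted
  dissipation `∫₀ᵗ ∫ₓ ρ̄ 𝒟h(f̂_{s,x})`;
* windows `winW γc N = (N+1)^{-(5/6 − 3γc/2)}` (`ν_N Δ → 0` while `m_cell ν_N Δ → ∞`), `win`, `nWin`;
* the LIFTED SMEARED CONTACT LAW `contactDens` at `(x, k)` on `Quad = V3⁴` with mass `contactMass`; its CHAOS
  REFERENCE `chaosDens` (the `G_h^{⊗4}`-smeared law of `(V, V_*, collide ω (V, V_*))` for `(V, V_*, ω) ~ f ⊗ f ⊗ B / Z`,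
  `f` the ATOMIC cell law at the window start); `klTerm`; `relEnt`; `chaosDissW`.

## Statements (`…On … t` = on the horizon `[0, t]`, all `localGibbsLaw`-probabilities of flow functionals)
`FewCollisionsOn`, `BudgetOn`, `BudgetDecompOn` (`budgetOn_of_decomp`), `OneSidedOn`, `EntropyChaosRelOn` (THE
RESIDUE), `ChaosSmallOn`, `DissipSmallOn`, `KineticClosureOn φ t` (the crux's conclusion event for ONE kernel family,
verbatim its `let ρb mb ub D q` telescope; `conclOn_iff`), and the seven registered stub statements
`FewCollisionsStub` (S0) · `EntropyBudgetStub` (S1) · `DVTransferStub` (S2) · `EntropyChaosRelStub` (S3, the residue) ·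
`ContactToMassStub` (S4) · `EEPClosureStub` (S5) · `CoarseningStub` (S6). The composition
(`AdaptedWeightCLT_of : S0 → … → S6 → CollisionIsometryCLT.AdaptedWeightCLT`) lives in the lead's skeleton and lands
last.
-/

namespace Summit.AtomisticToContinuum.HydrodynamicLimit.Theorems.BlockHDissipation

open scoped BigOperators Topology Classical MeasureTheory ENNReal InnerProductSpace
open Filter Set MeasureTheory
open Literature.Analysis.FluidPDE
open Summit.AtomisticToContinuum.HydrodynamicLimit.Theorems.ContactSourceDuhamel (T3 V3 Cfg Vel Flow Flows)
open Summit.AtomisticToContinuum.HydrodynamicLimit.Theorems.ContactSourceDuhamel.TimeLocal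
open Literature.MathematicalPhysics.KineticTheory (hsDiameter localGibbsLaw collide hardSphereKernel
  sphereMeasure)

noncomputable section

/-! ## §1 Objects -/

/-- Four velocities: `(v_a⁻, v_b⁻, v_a⁺, v_b⁺)` (pre-pair, post-pair). -/
abbrev Quad : Type := V3 × V3 × V3 × V3

/-- The pair-and-direction space `(V3 × V3) × S²` of the Boltzmann collision integrals. -/
abbrev PairDir : Type := (V3 × V3) × Metric.sphere (0 : V3) 1

/-- The measure `dv dv_* dω` on `PairDir` (as in the tree's `entropyProduction`). -/
def pairDirMeasure : Measure PairDir := ((volume : Measure V3).prod (volume : Measure V3)).prod sphereMeasure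

/-- Gaussian mollifier `G_h(v − u)` = the unit-mass Maxwellian with temperature `h²` centred at `u`. -/
def gauss (h : ℝ) (u v : V3) : ℝ := localMaxwellian 1 (h ^ 2) u v

/-- `G_h^{⊗4}` centred at a quadruple. -/
def gauss4 (h : ℝ) (c y : Quad) : ℝ :=
  gauss h c.1 y.1 * gauss h c.2.1 y.2.1 * gauss h c.2.2.1 y.2.2.1 * gauss h c.2.2.2 y.2.2.2

/-- Cell weight of particle `i` of the configuration `w` at `x`: `ψ_N(x_i − x)`. -/
def cw (N : ℕ) (ψ : ℕ → T3 → ℝ) (w : Cfg N) (x : T3) (i : Fin (N + 1)) : ℝ := ψ N ((w i).1 - x)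

/-- Total cell weight `W_x = Σ_i ψ_N(x_i − x) = (N+1) ρ̄(x)`. -/
def cW (N : ℕ) (ψ : ℕ → T3 → ℝ) (w : Cfg N) (x : T3) : ℝ := ∑ i, cw N ψ w x i

/-- Cell velocity `ū_x` (junk `0⁻¹ = 0` on an empty cell, as in the crux). -/
def cU (N : ℕ) (ψ : ℕ → T3 → ℝ) (w : Cfg N) (x : T3) : V3 := (cW N ψ w x)⁻¹ • ∑ i, cw N ψ w x i • (w i).2

/-- Cell temperature `θ̄_x = (3 W_x)⁻¹ Σ_i ψ_N(x_i − x) |v_i − ū_x|²`. -/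
def cT (N : ℕ) (ψ : ℕ → T3 → ℝ) (w : Cfg N) (x : T3) : ℝ :=
  (cW N ψ w x)⁻¹ * ∑ i, cw N ψ w x i * (‖(w i).2 - cU N ψ w x‖ ^ 2 / 3)

/-- The Gaussian kernel density estimate of the cell velocity law: `f̃_x(v) = W_x⁻¹ Σ_i ψ_N(x_i − x) G_h(v − v_i)`. -/
def kde (N : ℕ) (ψ : ℕ → T3 → ℝ) (h : ℝ) (w : Cfg N) (x : T3) (v : V3) : ℝ :=
  (cW N ψ w x)⁻¹ * ∑ i, cw N ψ w x i * gauss h (w i).2 v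

/-- The REGULARISED CELL LAW `f̂_x = (1 − δ) f̃_x + δ M_{1, θ̄_x + h², ū_x}` (co-moving, co-thermal Maxwellian
floor: same mean as the cell, `traceless Cov(f̂) = (1−δ) traceless Cov(f)`, `μ₃(f̂) = (1−δ) μ₃(f)` exactly). -/
def cellLaw (N : ℕ) (ψ : ℕ → T3 → ℝ) (h δ : ℝ) (w : Cfg N) (x : T3) (v : V3) : ℝ :=
  (1 - δ) * kde N ψ h w x v + δ * localMaxwellian 1 (cT N ψ w x + h ^ 2) (cU N ψ w x) v

/-- Entropy of the regularised cell law `H(f̂_x) = ∫ f̂ log f̂ dv`. -/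
def cellEnt (N : ℕ) (ψ : ℕ → T3 → ℝ) (h δ : ℝ) (w : Cfg N) (x : T3) : ℝ :=
  ∫ v, cellLaw N ψ h δ w x v * Real.log (cellLaw N ψ h δ w x v)

/-- The mass-weighted regularised cell entropy `S_N(w) = ∫ₓ ρ̄(x) H(f̂_x) dx`, `ρ̄ = W_x/(N+1)`. -/
def entS (N : ℕ) (ψ : ℕ → T3 → ℝ) (h δ : ℝ) (w : Cfg N) : ℝ :=
  ∫ x, ((N + 1 : ℕ) : ℝ)⁻¹ * cW N ψ w x * cellEnt N ψ h δ w x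

/-- FIRST-ORDER entropy increment from `w` to `w'` (same positions, so same weights):
`∫ₓ ρ̄ ∫ (1 + log f̂_{w,x}) (f̂_{w',x} − f̂_{w,x})`; the exact jump `S_N(w') − S_N(w)` exceeds it by a Bregman
remainder `≥ 0` (convexity of `a log a`). -/
def incr (N : ℕ) (ψ : ℕ → T3 → ℝ) (h δ : ℝ) (w w' : Cfg N) : ℝ :=
  ∫ x, ((N + 1 : ℕ) : ℝ)⁻¹ * cW N ψ w x *
    ∫ v, (1 + Real.log (cellLaw N ψ h δ w x v)) * (cellLaw N ψ h δ w' x v - cellLaw N ψ h δ w x v)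

/-- REALISED first-order entropy dissipation on `(0, t]` along the orbit of `z`: the collision pair sum (each
binary collision once, `i < j`) of `−incr(pre, post)`, the pre-collisional configuration read off the
post-collisional one through the elastic involution `collidePair`. Meaningful on `Φ.good`. -/
def realDiss (σ : ℝ) (N : ℕ) (Φ : Flow σ N) (ψ : ℕ → T3 → ℝ) (h δ t : ℝ) (z : Cfg N) : ℝ :=
  Φ.collisionPairSum (Set.Ioc 0 t)
    (fun _ w i j => if i < j then -incr N ψ h δ (collidePair (Torus.geometry (Fin 3)) i j w) w else 0) z

/-- TRANSPORT term of the budget on `[0, t]`: `∫₀ᵗ (d/dr)|_{r=0} S_N(freeFlight r (Φ_s z)) ds` (between collisions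
only positions move; the derivative sees `∇ψ_N`). -/
def transS (σ : ℝ) (N : ℕ) (Φ : Flow σ N) (ψ : ℕ → T3 → ℝ) (h δ t : ℝ) (z : Cfg N) : ℝ :=
  ∫ s in Icc 0 t, deriv (fun r : ℝ => entS N ψ h δ (freeFlight (Torus.geometry (Fin 3)) r (Φ.flow s z))) 0

/-- BREGMAN sum of the budget on `(0, t]`: the collision pair sum of the second-order remainders
`S_N(post) − S_N(pre) − incr(pre, post)` (each `≥ 0` by convexity of `a ↦ a log a`; small per contact when
`m_cell h³ δ ≫ 1`). -/
def bregS (σ : ℝ) (N : ℕ) (Φ : Flow σ N) (ψ : ℕ → T3 → ℝ) (h δ t : ℝ) (z : Cfg N) : ℝ :=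
  Φ.collisionPairSum (Set.Ioc 0 t)
    (fun _ w i j => if i < j then
      entS N ψ h δ w - entS N ψ h δ (collidePair (Torus.geometry (Fin 3)) i j w) -
        incr N ψ h δ (collidePair (Torus.geometry (Fin 3)) i j w) w else 0) z

/-- Energy-weighted COLLISION COUNT on `(0, t]`: `Σ_{collisions} (1 + |v_i|² + |v_j|²)` (post-collisional speeds;
the pair's `|v_i|² + |v_j|²` is conserved). Kinetic size `≍ ½ σ² (N+1)^{4/3} t`. -/
def collCount (σ : ℝ) (N : ℕ) (Φ : Flow σ N) (t : ℝ) (z : Cfg N) : ℝ :=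
  Φ.collisionPairSum (Set.Ioc 0 t) (fun _ w i j => if i < j then 1 + ‖(w i).2‖ ^ 2 + ‖(w j).2‖ ^ 2 else 0) z

/-- Flux normalisation `Z(f) = ∫ B(v − v_*, ω) f(v) f(v_*) dv dv_* dω` (`B = hardSphereKernel`). -/
def fluxZ (f : V3 → ℝ) : ℝ :=
  ∫ q : PairDir, hardSphereKernel q.1 q.2 * (f q.1.1 * f q.1.2) ∂pairDirMeasure

/-- The normalised HELLINGER DISSIPATION `𝒟h(f) = (2 Z(f))⁻¹ ∫ B (√(f′ f′_*) − √(f f_*))² ∈ [0, 1]`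
(`= 𝒟_{1/2}` of TRIAGE-r1-3 Panel note A; `1 − 𝒟h = E_{ff_*B/Z} √(f′f′_*/(f f_*))`). -/
def hellDiss (f : V3 → ℝ) : ℝ :=
  (2 * fluxZ f)⁻¹ * ∫ q : PairDir, hardSphereKernel q.1 q.2 *
    (Real.sqrt (f (collide q.2 q.1).1 * f (collide q.2 q.1).2) - Real.sqrt (f q.1.1 * f q.1.2)) ^ 2 ∂pairDirMeasure

/-- Chaotic dissipation CHARGED TO THE REALISED CONTACTS on `(0, t]`:
`Σ_{contacts (s,i,j)} (N+1)⁻¹ ∫ₓ (ψ_N(x_i − x) + ψ_N(x_j − x)) 𝒟h(f̂_{Φ_s z, x}) dx`. -/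
def chaosDiss (σ : ℝ) (N : ℕ) (Φ : Flow σ N) (ψ : ℕ → T3 → ℝ) (h δ t : ℝ) (z : Cfg N) : ℝ :=
  Φ.collisionPairSum (Set.Ioc 0 t)
    (fun _ w i j => if i < j then ((N + 1 : ℕ) : ℝ)⁻¹ *
      ∫ x, (cw N ψ w x i + cw N ψ w x j) * hellDiss (cellLaw N ψ h δ w x) else 0) z

/-- Mass-weighted dissipation `∫₀ᵗ ∫ₓ ρ̄_s(x) 𝒟h(f̂_{Φ_s z, x}) dx ds`. -/
def massDiss (σ : ℝ) (N : ℕ) (Φ : Flow σ N) (ψ : ℕ → T3 → ℝ) (h δ t : ℝ) (z : Cfg N) : ℝ :=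
  ∫ s in Icc 0 t, ∫ x, ((N + 1 : ℕ) : ℝ)⁻¹ * cW N ψ (Φ.flow s z) x * hellDiss (cellLaw N ψ h δ (Φ.flow s z) x)

/-- Window length `Δ_N = (N+1)^{-(5/6 − 3γc/2)}`: `ν_N Δ_N ≍ σ² (N+1)^{-(1−3γc)/2} → 0` (a particle collides
`o(1)` times per window) and `m_cell ν_N Δ_N ≍ σ^{-4} (N+1)^{(1−3γc)/2} → ∞` (a cell sees many contacts). -/
def winW (γc : ℝ) (N : ℕ) : ℝ := ((N + 1 : ℕ) : ℝ) ^ (-(5 / 6 - 3 * γc / 2))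

/-- The `k`-th window `(kΔ, (k+1)Δ] ∩ (0, t]`. -/
def win (γc : ℝ) (N : ℕ) (t : ℝ) (k : ℕ) : Set ℝ :=
  Set.Ioc ((k : ℝ) * winW γc N) (((k : ℝ) + 1) * winW γc N) ∩ Set.Ioc 0 t

/-- Number of windows meeting `(0, t]`. -/
def nWin (γc : ℝ) (N : ℕ) (t : ℝ) : ℕ := ⌈t / winW γc N⌉₊

/-- The contact quadruple of the ordered pair `(a, b)` in the post-collisional configuration `w`:
`(v_a⁻, v_b⁻, v_a⁺, v_b⁺)`, pre-velocities through `collidePair`. -/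
def quadOf (N : ℕ) (w : Cfg N) (a b : Fin (N + 1)) : Quad :=
  (((collidePair (Torus.geometry (Fin 3)) a b w) a).2, ((collidePair (Torus.geometry (Fin 3)) a b w) b).2,
    (w a).2, (w b).2)

/-- The LIFTED SMEARED CONTACT DENSITY at `(x, k)`: `Σ_{contacts in window k} Σ_{ordered pairs (a,b) in contact}
ψ_N(x_a − x) G_h^{⊗4}(y − quad(a,b))`, a smooth nonnegative function on `Quad`. -/
def contactDens (σ : ℝ) (N : ℕ) (Φ : Flow σ N) (ψ : ℕ → T3 → ℝ) (γc h t : ℝ) (z : Cfg N) (k : ℕ)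
    (x : T3) (y : Quad) : ℝ :=
  Φ.collisionPairSum (win γc N t k) (fun _ w a b => cw N ψ w x a * gauss4 h (quadOf N w a b) y) z

/-- Its mass `n_{x,k} = Σ_{contacts in window k} Σ_{ordered pairs} ψ_N(x_a − x)`. -/
def contactMass (σ : ℝ) (N : ℕ) (Φ : Flow σ N) (ψ : ℕ → T3 → ℝ) (γc t : ℝ) (z : Cfg N) (k : ℕ)
    (x : T3) : ℝ :=
  Φ.collisionPairSum (win γc N t k) (fun _ w a _ => cw N ψ w x a) z

/-- Pair flux of the ATOMIC cell law: `Z_x(w) = Σ_{l,l'} ψ_l ψ_{l'} ∫ B(v_l − v_{l'}, ω) dω`. -/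
def pairZ (N : ℕ) (ψ : ℕ → T3 → ℝ) (w : Cfg N) (x : T3) : ℝ :=
  ∑ l, ∑ l', cw N ψ w x l * cw N ψ w x l' * ∫ ω, hardSphereKernel ((w l).2, (w l').2) ω ∂sphereMeasure

/-- The CHAOS REFERENCE at `x` for the configuration `w`: the `G_h^{⊗4}`-smeared law of
`(V, V_*, collide ω (V, V_*))` for `(V, V_*, ω) ~ f ⊗ f ⊗ B / Z_x`, `f` the atomic cell law of `w` at `x`
(a probability density on `Quad` whenever `Z_x > 0`). -/
def chaosDens (N : ℕ) (ψ : ℕ → T3 → ℝ) (h : ℝ) (w : Cfg N) (x : T3) (y : Quad) : ℝ :=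
  (pairZ N ψ w x)⁻¹ * ∑ l, ∑ l', cw N ψ w x l * cw N ψ w x l' *
    ∫ ω, hardSphereKernel ((w l).2, (w l').2) ω *
      gauss4 h ((w l).2, (w l').2, (collide ω ((w l).2, (w l').2)).1, (collide ω ((w l).2, (w l').2)).2) y
      ∂sphereMeasure

/-- Relative entropy of the smeared contact law of window `k` at `x` with respect to (its mass times) the chaos
reference of the WINDOW-START configuration: `∫ p log (p / (n q)) dy` (`= n · KL(p/n ‖ q)`). -/
def klTerm (σ : ℝ) (N : ℕ) (Φ : Flow σ N) (ψ : ℕ → T3 → ℝ) (γc h t : ℝ) (z : Cfg N) (k : ℕ) (x : T3) : ℝ :=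
  ∫ y : Quad, contactDens σ N Φ ψ γc h t z k x y *
    Real.log (contactDens σ N Φ ψ γc h t z k x y /
      (contactMass σ N Φ ψ γc t z k x * chaosDens N ψ h (Φ.flow ((k : ℝ) * winW γc N) z) x y))

/-- RELATIVE ENTROPY-CHAOS functional on `(0, t]`: `(N+1)⁻¹ Σ_{k < nWin} ∫ₓ klTerm`. -/
def relEnt (σ : ℝ) (N : ℕ) (Φ : Flow σ N) (ψ : ℕ → T3 → ℝ) (γc h t : ℝ) (z : Cfg N) : ℝ :=
  ((N + 1 : ℕ) : ℝ)⁻¹ * ∑ k ∈ Finset.range (nWin γc N t), ∫ x, klTerm σ N Φ ψ γc h t z k x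

/-- Window-start chaotic dissipation `(N+1)⁻¹ Σ_k ∫ₓ n_{x,k} 𝒟h(f̂_{Φ_{kΔ} z, x})` (the twin of `chaosDiss`
consistent with `relEnt`'s reference). -/
def chaosDissW (σ : ℝ) (N : ℕ) (Φ : Flow σ N) (ψ : ℕ → T3 → ℝ) (γc h δ t : ℝ) (z : Cfg N) : ℝ :=
  ((N + 1 : ℕ) : ℝ)⁻¹ * ∑ k ∈ Finset.range (nWin γc N t),
    ∫ x, contactMass σ N Φ ψ γc t z k x * hellDiss (cellLaw N ψ h δ (Φ.flow ((k : ℝ) * winW γc N) z) x)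

/-! ## §2 Statements on the horizon `[0, t]` -/

/-- FEW COLLISIONS on `(0, t]` — the collision-count input along the non-equilibrium flow (the analogue of
`FewStepsOn` of line `contact-source-duhamel`, `…TLPastDampingInput.lean`: "nothing typed so far bounds collision
counts along the non-equilibrium local-Gibbs flow"): for every `p > 0`,
`P_N{collCount > (N+1)^{4/3 + p}} → 0` (polynomial slack over the kinetic count `≍ σ² (N+1)^{4/3} t`). -/
def FewCollisionsOn (σ : ℝ) (a₀ θ₀ : T3 → ℝ) (u₀ : T3 → V3) (Φ : Flows σ) (t : ℝ) : Prop :=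
  ∀ p : ℝ, 0 < p → Tendsto (fun N : ℕ => localGibbsLaw σ a₀ u₀ θ₀ N (Φ N)
    {z | ((N + 1 : ℕ) : ℝ) ^ ((4 : ℝ) / 3 + p) < collCount σ N (Φ N) t z}) atTop (𝓝 0)

/-- ENTROPY BUDGET on `[0, t]`: for every `p > 0`, `P_N{realDiss > (N+1)^{γc + p}} → 0`. -/
def BudgetOn (σ : ℝ) (a₀ θ₀ : T3 → ℝ) (u₀ : T3 → V3) (Φ : Flows σ) (ψ : ℕ → T3 → ℝ) (γc h δ t : ℝ) :
    Prop :=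
  ∀ p : ℝ, 0 < p → Tendsto (fun N : ℕ => localGibbsLaw σ a₀ u₀ θ₀ N (Φ N)
    {z | ((N + 1 : ℕ) : ℝ) ^ (γc + p) < realDiss σ N (Φ N) ψ h δ t z}) atTop (𝓝 0)

/-- ENTROPY BUDGET, DECOMPOSED: for every `p > 0`, with probability `→ 1` BOTH the exact telescoping identity
`realDiss = S_N(Φ_0 z) − S_N(Φ_t z) + transS + bregS` holds AND its right side is `≤ (N+1)^{γc+p}` (the identity
holds on the good set, which has full measure; the bound is statics + H2 + few collisions). Implies `BudgetOn`
(`budgetOn_of_decomp`). -/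
def BudgetDecompOn (σ : ℝ) (a₀ θ₀ : T3 → ℝ) (u₀ : T3 → V3) (Φ : Flows σ) (ψ : ℕ → T3 → ℝ)
    (γc h δ t : ℝ) : Prop :=
  ∀ p : ℝ, 0 < p → Tendsto (fun N : ℕ => localGibbsLaw σ a₀ u₀ θ₀ N (Φ N)
    {z | realDiss σ N (Φ N) ψ h δ t z ≠
        entS N ψ h δ ((Φ N).flow 0 z) - entS N ψ h δ ((Φ N).flow t z) +
          transS σ N (Φ N) ψ h δ t z + bregS σ N (Φ N) ψ h δ t z ∨
      ((N + 1 : ℕ) : ℝ) ^ (γc + p) <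
        entS N ψ h δ ((Φ N).flow 0 z) - entS N ψ h δ ((Φ N).flow t z) +
          transS σ N (Φ N) ψ h δ t z + bregS σ N (Φ N) ψ h δ t z}) atTop (𝓝 0)

/-- The decomposed budget implies the budget (monotonicity: if the identity holds, `realDiss` IS the right side). -/
theorem budgetOn_of_decomp {σ : ℝ} {a₀ θ₀ : T3 → ℝ} {u₀ : T3 → V3} {Φ : Flows σ} {ψ : ℕ → T3 → ℝ}
    {γc h δ t : ℝ} (hB : BudgetDecompOn σ a₀ θ₀ u₀ Φ ψ γc h δ t) : BudgetOn σ a₀ θ₀ u₀ Φ ψ γc h δ t := by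
  intro p hp
  refine tendsto_of_tendsto_of_tendsto_of_le_of_le' tendsto_const_nhds (hB p hp)
    (Eventually.of_forall fun N => bot_le) (Eventually.of_forall fun N => measure_mono fun z hz => ?_)
  simp only [mem_setOf_eq] at hz ⊢
  by_cases hid : realDiss σ N (Φ N) ψ h δ t z =
      entS N ψ h δ ((Φ N).flow 0 z) - entS N ψ h δ ((Φ N).flow t z) +
        transS σ N (Φ N) ψ h δ t z + bregS σ N (Φ N) ψ h δ t z
  · right; rwa [hid] at hz
  · left; exact hid

/-- ONE-SIDED ENTROPY CHAOS on `[0, t]` (aggregate, absolute slack): `∃ c₁ > 0 ∀ η > 0`,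
`P_N{realDiss + η (N+1)^{1/3} < c₁ · chaosDiss} → 0`. NOT a stub: certified `≡` rated `C⁺` modulo the budget by
the panel (r1-1/2/3); it is DERIVED from `EntropyChaosRelOn` by `stub_dvTransfer`. -/
def OneSidedOn (σ : ℝ) (a₀ θ₀ : T3 → ℝ) (u₀ : T3 → V3) (Φ : Flows σ) (ψ : ℕ → T3 → ℝ) (h δ t : ℝ) :
    Prop :=
  ∃ c₁ : ℝ, 0 < c₁ ∧ ∀ η : ℝ, 0 < η → Tendsto (fun N : ℕ => localGibbsLaw σ a₀ u₀ θ₀ N (Φ N)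
    {z | realDiss σ N (Φ N) ψ h δ t z + η * ((N + 1 : ℕ) : ℝ) ^ ((1 : ℝ) / 3) <
      c₁ * chaosDiss σ N (Φ N) ψ h δ t z}) atTop (𝓝 0)

/-- RELATIVE ENTROPY-CHAOS AT CONTACT on `[0, t]` (THE RESIDUE): `∃ c₀ ∈ (0, 1] ∀ η > 0`,
`P_N{relEnt > (1 − c₀) · chaosDissW + η (N+1)^{1/3}} → 0` — the lifted smeared law of the realised contacts of
each (cell, window) is close, in relative entropy, to the chaotic law of the cell's own particles, up to a FRACTION of
the cell law's Hellinger dissipation (the `σ³` ring stratum, `∃ σ₀`) and an `o(ν_N t)` aggregate slack. -/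
def EntropyChaosRelOn (σ : ℝ) (a₀ θ₀ : T3 → ℝ) (u₀ : T3 → V3) (Φ : Flows σ) (ψ : ℕ → T3 → ℝ)
    (γc h δ t : ℝ) : Prop :=
  ∃ c₀ : ℝ, 0 < c₀ ∧ c₀ ≤ 1 ∧ ∀ η : ℝ, 0 < η → Tendsto (fun N : ℕ => localGibbsLaw σ a₀ u₀ θ₀ N (Φ N)
    {z | (1 - c₀) * chaosDissW σ N (Φ N) ψ γc h δ t z + η * ((N + 1 : ℕ) : ℝ) ^ ((1 : ℝ) / 3) <
      relEnt σ N (Φ N) ψ γc h t z}) atTop (𝓝 0)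

/-- The contact-charged chaotic dissipation is `o(ν_N t)`: `∀ η > 0`, `P_N{chaosDiss > η (N+1)^{1/3}} → 0`. -/
def ChaosSmallOn (σ : ℝ) (a₀ θ₀ : T3 → ℝ) (u₀ : T3 → V3) (Φ : Flows σ) (ψ : ℕ → T3 → ℝ) (h δ t : ℝ) :
    Prop :=
  ∀ η : ℝ, 0 < η → Tendsto (fun N : ℕ => localGibbsLaw σ a₀ u₀ θ₀ N (Φ N)
    {z | η * ((N + 1 : ℕ) : ℝ) ^ ((1 : ℝ) / 3) < chaosDiss σ N (Φ N) ψ h δ t z}) atTop (𝓝 0)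

/-- The mass-weighted dissipation vanishes: `∀ η > 0`, `P_N{massDiss > η} → 0` (`C⁺` at cell scale). -/
def DissipSmallOn (σ : ℝ) (a₀ θ₀ : T3 → ℝ) (u₀ : T3 → V3) (Φ : Flows σ) (ψ : ℕ → T3 → ℝ) (h δ t : ℝ) :
    Prop :=
  ∀ η : ℝ, 0 < η → Tendsto (fun N : ℕ => localGibbsLaw σ a₀ u₀ θ₀ N (Φ N)
    {z | η < massDiss σ N (Φ N) ψ h δ t z}) atTop (𝓝 0)

/-- KINETIC CLOSURE on `[0, t]` for ONE kernel family `φ` (any exponent): the crux's conclusion event —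
`∀ δ > 0, P_N{∫₀ᵗ ∫ₓ Σ_{jk} D_{jk}² + |q|² > δ} → 0` — with the crux's `let ρb mb ub D q` telescope VERBATIM
(so that `ConclOn … t ↔ ∀ admissible block families, KineticClosureOn … t` is `Iff.rfl`, `conclOn_iff`). -/
def KineticClosureOn (σ : ℝ) (a₀ θ₀ : T3 → ℝ) (u₀ : T3 → V3) (Φ : Flows σ) (φ : ℕ → T3 → ℝ) (t : ℝ) :
    Prop :=
  let ρb := fun (N : ℕ) (s : ℝ) z (x : UnitAddTorus (Fin 3)) => Literature.MathematicalPhysics.KineticTheory.empiricalDensityField ((Φ N).flow s z) (fun y => φ N (y - x)); let mb := fun (N : ℕ) (s : ℝ) z (x : UnitAddTorus (Fin 3)) => Literature.MathematicalPhysics.KineticTheory.empiricalMomentumField ((Φ N).flow s z) (fun y => φ N (y - x)); let ub := fun (N : ℕ) (s : ℝ) z (x : UnitAddTorus (Fin 3)) => (ρb N s z x)⁻¹ • mb N s z x; let D := fun (N : ℕ) (s : ℝ) z (x : UnitAddTorus (Fin 3)) (j k : Fin 3) => (∫ y, φ N (y.1 - x) * ((y.2 j - ub N s z x j) * (y.2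 k - ub N s z x k)) ∂(Literature.Analysis.FluidPDE.empiricalMeasure ((Φ N).flow s z))) - (if j = k then (∑ l : Fin 3, ∫ y, φ N (y.1 - x) * (y.2 l - ub N s z x l) ^ 2 ∂(Literature.Analysis.FluidPDE.empiricalMeasure ((Φ N).flow s z))) / 3 else 0); let q := fun (N : ℕ) (s : ℝ) z (x : UnitAddTorus (Fin 3)) => ∫ y, (φ N (y.1 - x) * ‖y.2 - ub N s z x‖ ^ 2 / 2) • (y.2 - ub N s z x) ∂(Literature.Analysis.FluidPDE.empiricalMeasure ((Φ N).flow s z)); ∀ δ : ℝ, 0 < δ → Tendsto (fun N : ℕ => Literature.MathematicalPhysics.KineticTheory.localGibbsLaw σ a₀ u₀ θ₀ N (Φ N) {z | δ < ∫ s in Icc 0 t, ∫ x, ((∑ j, ∑ k, D N s z x j k ^ 2) + ‖q N s z x‖ ^ 2)}) atTop (𝓝 0)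

/-- The crux's per-horizon conclusion `ConclOn` (landed vocabulary) IS kinetic closure for every admissible block
family, definitionally. -/
theorem conclOn_iff (σ : ℝ) (a₀ θ₀ : T3 → ℝ) (u₀ : T3 → V3) (Φ : Flows σ) (t : ℝ) :
    ConclOn σ a₀ θ₀ u₀ Φ t ↔ ∀ (γ C : ℝ) (φ : ℕ → T3 → ℝ), 0 < γ → γ ≤ 1 / 15 → AdmissibleKernel γ C φ →
      KineticClosureOn σ a₀ θ₀ u₀ Φ φ t :=
  Iff.rfl

/-- Registration anchor of this vocabulary file (`--supports stmt-AtomisticToContinuum-14868`): the crux's per-horizon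
conclusion `ConclOn` is kinetic closure for every admissible block family (the `∀`-closed form of `conclOn_iff`). -/
theorem blockH_vocab_anchor : ∀ (σ : ℝ) (a₀ θ₀ : T3 → ℝ) (u₀ : T3 → V3) (Φ : Flows σ) (t : ℝ),
    ConclOn σ a₀ θ₀ u₀ Φ t ↔ ∀ (γ C : ℝ) (φ : ℕ → T3 → ℝ), 0 < γ → γ ≤ 1 / 15 → AdmissibleKernel γ C φ →
      KineticClosureOn σ a₀ θ₀ u₀ Φ φ t :=
  fun _ _ _ _ _ _ => Iff.rfl

/-! ## §3 Statements of the seven registered stubs -/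

/-- Statement of S0 (collision-count input). -/
def FewCollisionsStub : Prop :=
  ∀ (a₀ θ₀ : T3 → ℝ) (u₀ : T3 → V3), NiceProfiles a₀ θ₀ u₀ → ∀ σ : ℝ, 0 < σ → σ < 2⁻¹ →
    ∀ (Φ : Flows σ) (t : ℝ), 0 < t → TailsOn σ a₀ θ₀ u₀ Φ t → FewCollisionsOn σ a₀ θ₀ u₀ Φ t

/-- Statement of S1 (entropy budget: exact telescoping + a-priori bounds). -/
def EntropyBudgetStub : Prop :=
  ∀ (a₀ θ₀ : T3 → ℝ) (u₀ : T3 → V3), NiceProfiles a₀ θ₀ u₀ → ∀ σ : ℝ, 0 < σ → σ < 2⁻¹ →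
    ∀ (γc C' : ℝ) (ψ : ℕ → T3 → ℝ), 1 / 6 < γc → γc < 1 / 3 → AdmissibleKernel γc C' ψ →
      ∀ h δ : ℝ, 0 < h → h < 1 → 0 < δ → δ < 1 → ∀ (Φ : Flows σ) (t : ℝ), 0 < t →
        TailsOn σ a₀ θ₀ u₀ Φ t → FewCollisionsOn σ a₀ θ₀ u₀ Φ t → BudgetDecompOn σ a₀ θ₀ u₀ Φ ψ γc h δ t

/-- Statement of S2. -/
def DVTransferStub : Prop :=
  ∀ (a₀ θ₀ : T3 → ℝ) (u₀ : T3 → V3), NiceProfiles a₀ θ₀ u₀ → ∀ σ : ℝ, 0 < σ → σ < 2⁻¹ →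
    ∀ (γc C' : ℝ) (ψ : ℕ → T3 → ℝ), 1 / 6 < γc → γc < 1 / 3 → AdmissibleKernel γc C' ψ →
      ∀ (Φ : Flows σ) (t : ℝ), 0 < t → TailsOn σ a₀ θ₀ u₀ Φ t → FewCollisionsOn σ a₀ θ₀ u₀ Φ t →
        ∃ δ₀ : ℝ, 0 < δ₀ ∧ ∃ h₀ : ℝ, 0 < h₀ ∧ ∀ δ : ℝ, 0 < δ → δ < δ₀ → ∀ h : ℝ, 0 < h → h < h₀ →
          EntropyChaosRelOn σ a₀ θ₀ u₀ Φ ψ γc h δ t → OneSidedOn σ a₀ θ₀ u₀ Φ ψ h δ t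

/-- Statement of S3 (the residue). -/
def EntropyChaosRelStub : Prop :=
  ∀ (a₀ θ₀ : T3 → ℝ) (u₀ : T3 → V3), NiceProfiles a₀ θ₀ u₀ → ∃ σ₀ : ℝ, 0 < σ₀ ∧ ∀ σ : ℝ, 0 < σ → σ < σ₀ →
    ∀ (γc C' : ℝ) (ψ : ℕ → T3 → ℝ), 1 / 6 < γc → γc < 1 / 3 → AdmissibleKernel γc C' ψ →
      ∀ h δ : ℝ, 0 < h → h < 1 → 0 < δ → δ < 1 → ∀ Φ : Flows σ, DiffuseAt σ a₀ θ₀ u₀ Φ →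
        ∀ t : ℝ, 0 < t → TailsOn σ a₀ θ₀ u₀ Φ t → EntropyChaosRelOn σ a₀ θ₀ u₀ Φ ψ γc h δ t

/-- Statement of S4. -/
def ContactToMassStub : Prop :=
  ∀ (a₀ θ₀ : T3 → ℝ) (u₀ : T3 → V3), NiceProfiles a₀ θ₀ u₀ → ∀ σ : ℝ, 0 < σ → σ < 2⁻¹ →
    ∀ (γc C' : ℝ) (ψ : ℕ → T3 → ℝ), 1 / 6 < γc → γc < 1 / 3 → AdmissibleKernel γc C' ψ →
      ∀ h δ : ℝ, 0 < h → h < 1 → 0 < δ → δ < 1 → ∀ Φ : Flows σ, DiffuseAt σ a₀ θ₀ u₀ Φ →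
        ∀ t : ℝ, 0 < t → TailsOn σ a₀ θ₀ u₀ Φ t →
          ChaosSmallOn σ a₀ θ₀ u₀ Φ ψ h δ t → DissipSmallOn σ a₀ θ₀ u₀ Φ ψ h δ t

/-- Statement of S5 (the transfer `C⁺ ⇒ C` at cell scale). -/
def EEPClosureStub : Prop :=
  ∀ (a₀ θ₀ : T3 → ℝ) (u₀ : T3 → V3), NiceProfiles a₀ θ₀ u₀ → ∀ σ : ℝ, 0 < σ → σ < 2⁻¹ →
    ∀ (γc C' : ℝ) (ψ : ℕ → T3 → ℝ), 1 / 6 < γc → γc < 1 / 3 → AdmissibleKernel γc C' ψ →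
      ∀ h δ : ℝ, 0 < h → h < 1 → 0 < δ → δ < 1 → ∀ (Φ : Flows σ) (t : ℝ), 0 < t →
        TailsOn σ a₀ θ₀ u₀ Φ t → DissipSmallOn σ a₀ θ₀ u₀ Φ ψ h δ t → KineticClosureOn σ a₀ θ₀ u₀ Φ ψ t

/-- Statement of S6 (cells ⇒ blocks). -/
def CoarseningStub : Prop :=
  ∀ (a₀ θ₀ : T3 → ℝ) (u₀ : T3 → V3), NiceProfiles a₀ θ₀ u₀ → ∀ σ : ℝ, 0 < σ → σ < 2⁻¹ →
    ∀ γc : ℝ, 1 / 6 < γc → γc < 1 / 3 → ∀ Φ : Flows σ,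
      ∀ (γ C : ℝ) (φ : ℕ → T3 → ℝ), 0 < γ → γ ≤ 1 / 15 → AdmissibleKernel γ C φ →
        ∀ t : ℝ, 0 < t → TailsOn σ a₀ θ₀ u₀ Φ t →
          (∀ (C' : ℝ) (ψ : ℕ → T3 → ℝ), AdmissibleKernel γc C' ψ → KineticClosureOn σ a₀ θ₀ u₀ Φ ψ t) →
            KineticClosureOn σ a₀ θ₀ u₀ Φ φ t
end

end Summit.AtomisticToContinuum.HydrodynamicLimit.Theorems.BlockHDissipation
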